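import Literature.AlgebraicGeometry.Motives.HirschowitzIyerCovering
import HarnessLib

/-!
# Limits of fat flags are fat flags: the integral pivot for an arbitrary frame, and strong lines from fat flags over `K`

Two inputs of the VERTICAL half of Hirschowitz–Iyer 2010, Lemma 2.2 (`s = 0`): the fibres of the
ruled surface `H'_Z → Z` over closed points `z` must be strong lines (HI: "`pr_{2*}(ψ⁻¹(D))` lies in
`QCH^{(s+1)}_r(Y)`", i.e. is carried by strong `1`-planes). In the tree's valuative rendering
(`Motives/HirschowitzIyerCoveringValuative`, §3 "the Plücker pivot over a valuation ring") the
generic strong line, a `3`-fat flag `(u, v, y)` over the function field `L = K(Z)`, is moved into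
`𝒪⁹`, `𝒪 = 𝒪_{Z,z}` a valuation ring of `L`, in chart normal form, and then reduced modulo `𝔪_z`.

* `StrongLineCover.exists_integral_fatFlag_of_linearIndependent` — the pivot of
  `exists_integral_fatFlag` for an ARBITRARY linearly independent fat flag `(x, a, y)` (no
  unitriangular normalisation of the input is assumed): a fat flag `(u, v, w) ∈ (𝒪⁹)³` of the same
  line and plane in chart normal form (`u_{i₀} = 1`, `u_{j₀} = 0`, `v_{i₀} = 0`, `v_{j₀} = 1`,
  `w_{i₀} = w_{j₀} = 0`, `w_{c₀} = 1`).
* `StrongLineCover.linearIndependent_of_chartNormalForm` — vectors in chart normal form are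
  linearly independent (over any field; used after reduction).
* `exists_isStrongLinePoint_of_fatFlag` — **a fat flag over `K` gives a strong line**: for
  `K` algebraically closed, forms `Q, C` of degrees `2, 3` on `ℙ⁸_K` and an independent fat flag
  `(u, v, w)` for `(Q, C)` there is a strong line point `ℓ` of `V₊(Q, C)` (`IsStrongLinePoint`) whose
  line `closure {ℓ} ⊆ ℙ⁸` contains every point at which all linear forms vanishing on `span(u, v)`
  vanish (the packaging of `Motives/HirschowitzIyerCovering`, run on a GIVEN flag).

## References

* A. Hirschowitz, J. N. N. Iyer, Contemp. Math. 522 (2010), arXiv:0903.5018, §2 Lemma 2.2 (proof),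
  §2 Prop. 2.3. [HirschowitzIyer2010]
* W. Fulton, *Intersection Theory* (1998), §10.1. [Fulton1998]
-/

noncomputable section

open MvPolynomial

universe u

namespace Literature.AlgebraicGeometry.Motives

namespace StrongLineCover

/-! ### The pivot for an arbitrary independent frame -/

section Pivot

variable {L : Type*} [Field L] {𝒪 : ValuationSubring L}
variable {B : Fin 9 → Fin 9 → L} {T : Fin 9 × Fin 9 × Fin 9 → L} {x a y : Fin 9 → L}

/-- An independent pair has a non-zero Plücker coordinate. [folklore] -/
theorem exists_pluecker_ne_zero (h : LinearIndependent L ![x, a]) :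
    ∃ ij : Fin 9 × Fin 9, x ij.1 * a ij.2 - x ij.2 * a ij.1 ≠ 0 := by
  by_contra hall
  push Not at hall
  have hx : x ≠ 0 := by
    have := h.ne_zero 0
    simpa using this
  obtain ⟨i, hi⟩ := Function.ne_iff.mp hx
  have hrel : (a i) • x + (-(x i)) • a = 0 := by
    funext j
    have := hall (i, j)
    simp only [Pi.add_apply, Pi.smul_apply, smul_eq_mul, Pi.zero_apply, neg_mul]
    linear_combination -this
  have h2 := (LinearIndependent.pair_iff.mp h) (a i) (-(x i)) hrel
  exact hi (neg_eq_zero.mp h2.2)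

/-- **The pivot for an arbitrary independent fat flag.** For a fat flag `(x, a, y)` over the
field `L` with `x, a, y` linearly independent and a valuation subring `𝒪 ⊆ L`, there is a fat flag
`(u, v, w)` of the SAME line and plane with `u, v, w ∈ 𝒪⁹` in chart normal form. [folklore] -/
theorem exists_integral_fatFlag_of_linearIndependent (hli : LinearIndependent L ![x, a, y])
    (hfat : IsFatFlag B T x a y) :
    ∃ (i₀ j₀ c₀ : Fin 9) (u v w : Fin 9 → L),
      (∀ i, u i ∈ 𝒪) ∧ (∀ i, v i ∈ 𝒪) ∧ (∀ i, w i ∈ 𝒪) ∧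
      u i₀ = 1 ∧ u j₀ = 0 ∧ v i₀ = 0 ∧ v j₀ = 1 ∧ w i₀ = 0 ∧ w j₀ = 0 ∧ w c₀ = 1 ∧
      (∃ α β γ δ : L, u = α • x + β • a ∧ v = γ • x + δ • a) ∧
      (∀ i, x i = x i₀ * u i + x j₀ * v i) ∧ (∀ i, a i = a i₀ * u i + a j₀ * v i) ∧
      (∃ la μ ν : L, la ≠ 0 ∧ w = la • y + μ • x + ν • a) ∧ IsFatFlag B T u v w := by
  have hli2 : LinearIndependent L ![x, a] := by
    have h := hli.comp (Fin.castSucc : Fin 2 → Fin 3) (Fin.castSucc_injective 2)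
    have heq : (![x, a, y] : Fin 3 → Fin 9 → L) ∘ (Fin.castSucc : Fin 2 → Fin 3) = ![x, a] := by
      funext i; fin_cases i <;> rfl
    rwa [heq] at h
  -- the Plücker matrix and its pivot
  set p : Fin 9 × Fin 9 → L := fun ij => x ij.1 * a ij.2 - x ij.2 * a ij.1 with hp
  obtain ⟨ij₁, hij₁⟩ := exists_pluecker_ne_zero hli2
  obtain ⟨⟨i₀, j₀⟩, hπ, hdiv⟩ := exists_forall_div_mem 𝒪 p (i₁ := ij₁) hij₁
  set π := p (i₀, j₀) with hπdef
  have hπ' : x i₀ * a j₀ - x j₀ * a i₀ ≠ 0 := hπ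
  -- the normalised frame of the line
  set u : Fin 9 → L := fun i => p (i, j₀) / π with hu
  set v : Fin 9 → L := fun j => p (i₀, j) / π with hv
  have hu_mem : ∀ i, u i ∈ 𝒪 := fun i => hdiv (i, j₀)
  have hv_mem : ∀ j, v j ∈ 𝒪 := fun j => hdiv (i₀, j)
  have hui : u i₀ = 1 := by simp only [hu]; rw [← hπdef]; exact div_self hπ
  have huj : u j₀ = 0 := by simp [hu, hp]
  have hvi : v i₀ = 0 := by simp [hv, hp]
  have hvj : v j₀ = 1 := by simp only [hv]; rw [← hπdef]; exact div_self hπ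
  have hxuv : ∀ i, x i = x i₀ * u i + x j₀ * v i := by
    intro i
    simp only [hu, hv, hp]
    field_simp
    ring
  have hauv : ∀ i, a i = a i₀ * u i + a j₀ * v i := by
    intro i
    simp only [hu, hv, hp]
    field_simp
    ring
  -- `u`, `v` as combinations of `x`, `a`
  have hu_eq : u = (a j₀ / π) • x + (-(x j₀) / π) • a := by
    ext i; simp only [hu, hp, Pi.add_apply, Pi.smul_apply, smul_eq_mul]; field_simp; ring
  have hv_eq : v = (-(a i₀) / π) • x + (x i₀ / π) • a := by
    ext i; simp only [hv, hp, Pi.add_apply, Pi.smul_apply, smul_eq_mul]; field_simp; ring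
  have hfat_uv : IsFatFlag B T u v y := by
    have h := hfat.baseChange (a j₀ / π) (-(x j₀) / π) (-(a i₀) / π) (x i₀ / π) 1 0 0
    rw [← hu_eq, ← hv_eq] at h
    simpa using h
  -- normalise `y` modulo the line
  set y' : Fin 9 → L := y - y i₀ • u - y j₀ • v with hy'
  have hy'i : y' i₀ = 0 := by simp [hy', hui, hvi]
  have hy'j : y' j₀ = 0 := by simp [hy', huj, hvj]
  have hy'ne : y' ≠ 0 := by
    intro hz
    -- then `y ∈ span(x, a)`, contradicting independence
    have hyuv : y = y i₀ • u + y j₀ • v := by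
      have : y - y i₀ • u - y j₀ • v = 0 := hz
      funext i
      have hi := congrFun this i
      simp only [Pi.sub_apply, Pi.smul_apply, smul_eq_mul, Pi.zero_apply] at hi
      simp only [Pi.add_apply, Pi.smul_apply, smul_eq_mul]
      linear_combination hi
    rw [hu_eq, hv_eq] at hyuv
    -- a relation `A x + B a - y = 0`
    set A : L := y i₀ * (a j₀ / π) + y j₀ * (-(a i₀) / π) with hA
    set B' : L := y i₀ * (-(x j₀) / π) + y j₀ * (x i₀ / π) with hB'
    have hrel : ∑ k : Fin 3, (![A, B', -1] : Fin 3 → L) k • (![x, a, y] : Fin 3 → Fin 9 → L) k = 0 := by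
      rw [Fin.sum_univ_three]
      funext i
      have hi := congrFun hyuv i
      simp only [Pi.add_apply, Pi.smul_apply, smul_eq_mul] at hi
      simp only [Matrix.cons_val_zero, Matrix.cons_val_one, Matrix.cons_val, Pi.add_apply,
        Pi.smul_apply, smul_eq_mul, Pi.zero_apply, hA, hB']
      linear_combination -hi
    have h := (Fintype.linearIndependent_iff.mp hli) _ hrel 2
    simp at h
  obtain ⟨c₁, hc₁⟩ : ∃ c, y' c ≠ 0 := Function.ne_iff.mp hy'ne
  obtain ⟨c₀, hc₀, hwdiv⟩ := exists_forall_div_mem 𝒪 y' hc₁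
  set w : Fin 9 → L := fun i => y' i / y' c₀ with hw
  refine ⟨i₀, j₀, c₀, u, v, w, hu_mem, hv_mem, hwdiv, hui, huj, hvi, hvj, ?_, ?_, ?_,
    ⟨_, _, _, _, hu_eq, hv_eq⟩, hxuv, hauv, ?_, ?_⟩
  · simp [hw, hy'i]
  · simp [hw, hy'j]
  · simp [hw, div_self hc₀]
  · refine ⟨1 / y' c₀, -(y i₀) / y' c₀ * (a j₀ / π) + -(y j₀) / y' c₀ * (-(a i₀) / π),
      -(y i₀) / y' c₀ * (-(x j₀) / π) + -(y j₀) / y' c₀ * (x i₀ / π), by simp [hc₀], ?_⟩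
    ext i
    simp only [hw, hy', hu, hv, hp, Pi.add_apply, Pi.sub_apply, Pi.smul_apply, smul_eq_mul]
    field_simp
    ring
  · have h := hfat_uv.baseChange 1 0 0 1 (1 / y' c₀) (-(y i₀) / y' c₀) (-(y j₀) / y' c₀)
    have hw_eq : (1 / y' c₀) • y + (-(y i₀) / y' c₀) • u + (-(y j₀) / y' c₀) • v = w := by
      ext i
      simp only [hw, hy', Pi.add_apply, Pi.sub_apply, Pi.smul_apply, smul_eq_mul]
      field_simp
      ring
    rw [hw_eq] at h
    simpa using h

end Pivot

/-! ### Chart normal form implies independence -/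

section NormalForm

variable {R : Type*} [Field R]

/-- Vectors in chart normal form are linearly independent. [folklore] -/
theorem linearIndependent_of_chartNormalForm {u v w : Fin 9 → R} {i₀ j₀ c₀ : Fin 9}
    (hui : u i₀ = 1) (huj : u j₀ = 0) (hvi : v i₀ = 0) (hvj : v j₀ = 1)
    (hwi : w i₀ = 0) (hwj : w j₀ = 0) (hwc : w c₀ = 1) : LinearIndependent R ![u, v, w] := by
  rw [Fintype.linearIndependent_iff]
  intro g hg
  have h0 := congrFun hg i₀
  have h1 := congrFun hg j₀
  have h2 := congrFun hg c₀
  simp only [Fin.sum_univ_three, Matrix.cons_val_zero, Matrix.cons_val_one, Matrix.cons_val,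
    Pi.add_apply, Pi.smul_apply, smul_eq_mul, Pi.zero_apply, hui, huj, hvi, hvj, hwi, hwj, hwc,
    mul_one, mul_zero, add_zero, zero_add] at h0 h1 h2
  intro i
  fin_cases i
  · exact h0
  · exact h1
  · simp only [h0, h1, zero_mul, zero_add] at h2
    exact h2

end NormalForm


end StrongLineCover

/-! ### Strong lines from fat flags over `K` -/

section FatFlagToStrongLine

open _root_.CategoryTheory _root_.AlgebraicGeometry _root_.Order _root_.Topology _root_.TopologicalSpace StrongLineCover

variable {K : Type u} [Field K]

attribute [local instance] MvPolynomial.gradedAlgebra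

/-- **A fat flag over `K` gives a strong line** (the packaging of `exists_isStrongLinePoint_of_isClosed`
run on a GIVEN flag): for a quadric `Q` and a cubic `C` on `ℙ⁸_K` (`K` algebraically closed), an
independent `3`-fat flag `(u, v, w)` (`Q ≡ 0` on `span(u, v, w)`, `C(c₀u + c₁v + c₂w) = c₂³ C(w)`) and
`7` independent linear forms `Lf` cutting out `span(u, v)` whose ideal contains every polynomial
vanishing on `span(u, v)`, the line `V₊(Lf)` is (the closure of) a STRONG LINE POINT of
`V₊(Q, C) ⊂ V₊(Q)`. [cite: HirschowitzIyer2010, §2 Prop. 2.3] -/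
theorem exists_isStrongLinePoint_of_fatFlag [IsAlgClosed K]
    {Q C : MvPolynomial (Fin (8 + 1)) K} {u v w : Fin 9 → K} (hli : LinearIndependent K ![u, v, w])
    (hQvan : ∀ c : Fin 3 → K, MvPolynomial.eval (comb u v w c) Q = 0)
    (hCfat : ∀ c : Fin 3 → K, MvPolynomial.eval (comb u v w c) C = c 2 ^ 3 * MvPolynomial.eval w C)
    (Lf : Fin (8 - 1) → MvPolynomial (Fin (8 + 1)) K) (hLli : LinearIndependent K Lf)
    (hLhom : ∀ j, (Lf j).IsHomogeneous 1)
    (hLuniv : ∀ G : MvPolynomial (Fin (8 + 1)) K,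
      (∀ q ∈ Submodule.span K (Set.range ![u, v]), MvPolynomial.eval q G = 0) → G ∈ Ideal.span (Set.range Lf)) :
    ∃ ℓ : ↥(quadricCubic Q C).left, IsStrongLinePoint Q C 1 ℓ ∧
      closure {quadricι Q ((quadricCubicToQuadric Q C).left ℓ)} =
        ProjectiveSpectrum.zeroLocus (MvPolynomial.homogeneousSubmodule (Fin (8 + 1)) K) (Set.range Lf) := by
  classical
  set iY := completeIntersectionι ![Q, C] with hiY
  set iQ := completeIntersectionι (fun _ : Fin 1 => Q) with hiQ
  have hV : Set.range iY.left.base =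
      ProjectiveSpectrum.zeroLocus (MvPolynomial.homogeneousSubmodule (Fin (8 + 1)) K) (Set.range ![Q, C]) :=
    range_completeIntersectionι _
  -- the linear form `ℓ` of the line inside the plane: `ℓ(u) = ℓ(v) = 0`, `ℓ(w) = 1`
  have hlio : LinearIndepOn K id (Set.range ![u, v, w]) := hli.linearIndepOn_id
  set b := Module.Basis.extend hlio with hb
  have hbself : ∀ i, b i = (i : Fin (8 + 1) → K) := Module.Basis.extend_apply_self hlio
  have hsub : Set.range ![u, v, w] ⊆ hlio.extend (Set.subset_univ _) := hlio.subset_extend _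
  set iu : ↥(hlio.extend (Set.subset_univ _)) := ⟨u, hsub ⟨0, rfl⟩⟩ with hiu
  set iv : ↥(hlio.extend (Set.subset_univ _)) := ⟨v, hsub ⟨1, rfl⟩⟩ with hiv
  set iw : ↥(hlio.extend (Set.subset_univ _)) := ⟨w, hsub ⟨2, rfl⟩⟩ with hiw
  set ℓ : MvPolynomial (Fin (8 + 1)) K := ∑ m : Fin (8 + 1), MvPolynomial.C (b.repr (Pi.single m 1) iw) * X m with hℓ
  have hℓeval : ∀ q, MvPolynomial.eval q ℓ = b.repr q iw := fun q =>
    Literature.RingTheory.MvPolynomial.eval_coordForm b iw q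
  have hℓhom : ℓ.IsHomogeneous 1 := Literature.RingTheory.MvPolynomial.isHomogeneous_coordForm b iw
  have hinj := hli.injective
  have huw : iu ≠ iw := by
    intro h; have h' := congrArg Subtype.val h
    exact absurd (hinj (show (![u, v, w] : Fin 3 → _) 0 = ![u, v, w] 2 from h')) (by decide)
  have hvw : iv ≠ iw := by
    intro h; have h' := congrArg Subtype.val h
    exact absurd (hinj (show (![u, v, w] : Fin 3 → _) 1 = ![u, v, w] 2 from h')) (by decide)
  have hrepr : ∀ i : ↥(hlio.extend (Set.subset_univ _)), b.repr (i : Fin (8 + 1) → K) = Finsupp.single i 1 := by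
    intro i
    have h := b.repr_self i
    rwa [hbself] at h
  have hℓu : MvPolynomial.eval u ℓ = 0 := by
    rw [hℓeval]
    change b.repr (iu : Fin (8 + 1) → K) iw = 0
    rw [hrepr, Finsupp.single_apply, if_neg huw]
  have hℓv : MvPolynomial.eval v ℓ = 0 := by
    rw [hℓeval]
    change b.repr (iv : Fin (8 + 1) → K) iw = 0
    rw [hrepr, Finsupp.single_apply, if_neg hvw]
  have hℓw : MvPolynomial.eval w ℓ = 1 := by
    rw [hℓeval]
    change b.repr (iw : Fin (8 + 1) → K) iw = 1
    rw [hrepr, Finsupp.single_apply, if_pos rfl]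
  have hℓcomb : ∀ c : Fin 3 → K, MvPolynomial.eval (comb u v w c) ℓ = c 2 := by
    intro c
    rw [hℓeval]
    simp only [comb, map_add, map_smul, Finsupp.add_apply, Finsupp.smul_apply, smul_eq_mul]
    rw [← hℓeval, ← hℓeval, ← hℓeval, hℓu, hℓv, hℓw]; ring
  set lam : K := MvPolynomial.eval w C with hlam
  -- the plane forms
  set FP : Bool → MvPolynomial (Fin (8 + 1)) K := fun s => if s then C - MvPolynomial.C lam * ℓ ^ 3 else Q with hFP
  have hFPvan : ∀ s, ∀ q ∈ Submodule.span K (Set.range ![u, v, w]), MvPolynomial.eval q (FP s) = 0 := by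
    intro s q hq
    obtain ⟨c, rfl⟩ := exists_comb_of_mem_span hq
    cases s
    · simp only [hFP]; exact hQvan c
    · simp only [hFP, if_true, map_sub, map_mul, map_pow, MvPolynomial.eval_C, hℓcomb, hCfat c, hlam]
      ring
  obtain ⟨tP, M, htP, hMli, hMhom, hFM, hMvan⟩ :=
    EsnaultLevineViehweg.exists_linearForms_forall_mem_ideal_span FP hli hFPvan
  obtain rfl : tP = 8 - 2 := by omega
  -- the line forms are given: everything vanishing on `span(u, v)` lies in their ideal
  have hQmem : Q ∈ Ideal.span (Set.range Lf) := by
    refine hLuniv Q fun q hq => ?_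
    obtain ⟨c, hc2, rfl⟩ := exists_comb_of_mem_span_pair (w := w) hq
    exact hQvan c
  have hCmem : C ∈ Ideal.span (Set.range Lf) := by
    refine hLuniv C fun q hq => ?_
    obtain ⟨c, hc2, rfl⟩ := exists_comb_of_mem_span_pair (w := w) hq
    rw [hCfat c, hc2]; ring
  have hMmem : ∀ j, M j ∈ Ideal.span (Set.range Lf) := fun j =>
    hLuniv (M j) fun q hq => by
      obtain ⟨c, hc2, rfl⟩ := exists_comb_of_mem_span_pair (w := w) hq
      exact hMvan j _ (comb_mem_span u v w c)
  -- the plane point of `V₊(Q)`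
  have hrangeQ : Set.range iQ.left.base =
      ProjectiveSpectrum.zeroLocus (MvPolynomial.homogeneousSubmodule (Fin (8 + 1)) K) (Set.range (fun _ : Fin 1 => Q)) :=
    range_completeIntersectionι _
  have hsubP : ProjectiveSpectrum.zeroLocus (MvPolynomial.homogeneousSubmodule (Fin (8 + 1)) K)
      (Set.range M) ⊆ Set.range iQ.left.base := by
    intro q hq
    have hqM := (ProjectiveSpectrum.mem_zeroLocus _ _ _).mp hq
    have hspan : Ideal.span (Set.range M) ≤
        (ProjectiveSpectrum.asHomogeneousIdeal (𝒜 := MvPolynomial.homogeneousSubmodule (Fin (8 + 1)) K) q).toIdeal :=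
      Ideal.span_le.mpr hqM
    have hq' : (q : ↥(projectiveSpace 8 K).left) ∈
        ProjectiveSpectrum.zeroLocus (MvPolynomial.homogeneousSubmodule (Fin (8 + 1)) K)
          (Set.range (fun _ : Fin 1 => Q)) :=
      (ProjectiveSpectrum.mem_zeroLocus _ _ _).mpr (by
        rintro _ ⟨j, rfl⟩
        exact hspan (hFM false))
    have hq'' : (q : ↥(projectiveSpace 8 K).left) ∈ Set.range iQ.left.base := by
      rw [hrangeQ]; exact hq'
    exact hq''
  obtain ⟨wpt, hwpt, himgP⟩ :=
    EsnaultLevineViehweg.exists_isLinearSubspacePoint_of_zeroLocus_subset iQ (r := 2) (by norm_num) M hMli hMhom hsubP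
  -- the line point of `V₊(Q, C)`
  have hsubL : ProjectiveSpectrum.zeroLocus (MvPolynomial.homogeneousSubmodule (Fin (8 + 1)) K)
      (Set.range Lf) ⊆ Set.range iY.left.base := by
    intro q hq
    have hqL := (ProjectiveSpectrum.mem_zeroLocus _ _ _).mp hq
    have hspan : Ideal.span (Set.range Lf) ≤
        (ProjectiveSpectrum.asHomogeneousIdeal (𝒜 := MvPolynomial.homogeneousSubmodule (Fin (8 + 1)) K) q).toIdeal :=
      Ideal.span_le.mpr hqL
    have hq' : (q : ↥(projectiveSpace 8 K).left) ∈
        ProjectiveSpectrum.zeroLocus (MvPolynomial.homogeneousSubmodule (Fin (8 + 1)) K) (Set.range ![Q, C]) :=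
      (ProjectiveSpectrum.mem_zeroLocus _ _ _).mpr (by
        rintro _ ⟨j, rfl⟩
        fin_cases j
        · exact hspan hQmem
        · exact hspan hCmem)
    have hq'' : (q : ↥(projectiveSpace 8 K).left) ∈ Set.range iY.left.base := by
      rw [hV]; exact hq'
    exact hq''
  obtain ⟨vpt, hvpt, himgL⟩ :=
    EsnaultLevineViehweg.exists_isLinearSubspacePoint_of_zeroLocus_subset iY (r := 1) (by norm_num) Lf hLli hLhom hsubL
  -- closures in `ℙ⁸`
  have hclP : closure {quadricι Q wpt} =
      ProjectiveSpectrum.zeroLocus (MvPolynomial.homogeneousSubmodule (Fin (8 + 1)) K) (Set.range M) := by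
    change closure ({iQ.left.base wpt} : Set ↥(projectiveSpace 8 K).left) = _
    rw [← image_closure_singleton_of_isClosedMap iQ.left iQ.left.isClosedMap wpt]
    exact himgP
  have hbase : iY.left vpt = iQ.left ((quadricCubicToQuadric Q C).left vpt) := by
    rw [← Scheme.Hom.comp_apply, ← Over.comp_left, quadricCubicToQuadric_ι]
  have hclL : closure {quadricι Q ((quadricCubicToQuadric Q C).left vpt)} =
      ProjectiveSpectrum.zeroLocus (MvPolynomial.homogeneousSubmodule (Fin (8 + 1)) K) (Set.range Lf) := by
    change closure ({iQ.left.base ((quadricCubicToQuadric Q C).left vpt)} : Set ↥(projectiveSpace 8 K).left) = _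
    rw [← hbase, ← image_closure_singleton_of_isClosedMap iY.left iY.left.isClosedMap vpt]
    exact himgL
  refine ⟨vpt, ⟨hvpt, wpt, ⟨hwpt, ?_⟩, ?_⟩, hclL⟩
  · -- the strong-plane alternative
    by_cases hlam0 : lam = 0
    · left
      rw [hclP]
      intro q hq
      have hqM := (ProjectiveSpectrum.mem_zeroLocus _ _ _).mp hq
      have hspan : Ideal.span (Set.range M) ≤
          (ProjectiveSpectrum.asHomogeneousIdeal (𝒜 := MvPolynomial.homogeneousSubmodule (Fin (8 + 1)) K) q).toIdeal :=
        Ideal.span_le.mpr hqM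
      refine (ProjectiveSpectrum.mem_zeroLocus _ _ _).mpr (Set.singleton_subset_iff.mpr ?_)
      have hCmem : C ∈ Ideal.span (Set.range M) := by
        have h := hFM true
        simp only [hFP, if_true, hlam0, map_zero, zero_mul, sub_zero] at h
        exact h
      exact hspan hCmem
    · right
      refine ⟨ℓ, (mem_homogeneousSubmodule _ _).mpr hℓhom, ?_, ?_⟩
      · -- `ℓ ∉ 𝔭_Π`: the ideal of the plane point is `(M)`, whose members vanish at `w`, but `ℓ(w) = 1`
        intro hmem
        have hgen : quadricι Q wpt = linearSubspacePoint M hMli hMhom (by norm_num) :=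
          eq_linearSubspacePoint_of_closure_eq M hMli hMhom (by norm_num) hclP
        have hmem' : ℓ ∈ (ProjectiveSpectrum.asHomogeneousIdeal
            (𝒜 := MvPolynomial.homogeneousSubmodule (Fin (8 + 1)) K) (linearSubspacePoint M hMli hMhom (by norm_num))).toIdeal := by
          rw [← hgen]; exact hmem
        rw [toIdeal_linearSubspacePoint] at hmem'
        have hker : Ideal.span (Set.range M) ≤ RingHom.ker (MvPolynomial.eval w) := by
          rw [Ideal.span_le]; rintro _ ⟨j, rfl⟩
          exact hMvan j w (Submodule.subset_span ⟨2, rfl⟩)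
        have h0 := hker hmem'
        rw [RingHom.mem_ker, hℓw] at h0
        exact one_ne_zero h0
      · -- `Π ∩ V₊(C) = Π ∩ V₊(ℓ)`
        rw [hclP]
        ext q
        simp only [Set.mem_inter_iff]
        constructor
        all_goals rintro ⟨hqM, hq⟩; refine ⟨hqM, ?_⟩
        all_goals
          have hqM' := (ProjectiveSpectrum.mem_zeroLocus _ _ _).mp hqM
          have hspan : Ideal.span (Set.range M) ≤
              (ProjectiveSpectrum.asHomogeneousIdeal (𝒜 := MvPolynomial.homogeneousSubmodule (Fin (8 + 1)) K) q).toIdeal :=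
            Ideal.span_le.mpr hqM'
          have hdiff : C - MvPolynomial.C lam * ℓ ^ 3 ∈
              (ProjectiveSpectrum.asHomogeneousIdeal (𝒜 := MvPolynomial.homogeneousSubmodule (Fin (8 + 1)) K) q).toIdeal := by
            have h := hFM true
            simp only [hFP, if_true] at h
            exact hspan h
          have hprime := q.isPrime
          have hq' := Set.singleton_subset_iff.mp ((ProjectiveSpectrum.mem_zeroLocus _ _ _).mp hq)
          refine (ProjectiveSpectrum.mem_zeroLocus _ _ _).mpr (Set.singleton_subset_iff.mpr ?_)
        · -- `C ∈ 𝔮 → ℓ ∈ 𝔮`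
          have h3 : MvPolynomial.C lam * ℓ ^ 3 ∈
              (ProjectiveSpectrum.asHomogeneousIdeal (𝒜 := MvPolynomial.homogeneousSubmodule (Fin (8 + 1)) K) q).toIdeal := by
            have := Ideal.sub_mem _ hq' hdiff
            simpa using this
          have h3' : ℓ ^ 3 ∈
              (ProjectiveSpectrum.asHomogeneousIdeal (𝒜 := MvPolynomial.homogeneousSubmodule (Fin (8 + 1)) K) q).toIdeal := by
            have hu : IsUnit (MvPolynomial.C lam : MvPolynomial (Fin (8 + 1)) K) :=
              (isUnit_iff_ne_zero.mpr hlam0).map MvPolynomial.C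
            exact (Ideal.unit_mul_mem_iff_mem _ hu).mp h3
          exact hprime.mem_of_pow_mem 3 h3'
        · -- `ℓ ∈ 𝔮 → C ∈ 𝔮`
          have h3 : MvPolynomial.C lam * ℓ ^ 3 ∈
              (ProjectiveSpectrum.asHomogeneousIdeal (𝒜 := MvPolynomial.homogeneousSubmodule (Fin (8 + 1)) K) q).toIdeal :=
            Ideal.mul_mem_left _ _ (Ideal.pow_mem_of_mem _ hq' 3 (by norm_num))
          have := Ideal.add_mem _ hdiff h3
          simpa using this
  · -- the line lies in the plane
    rw [hclL, hclP]
    intro q hq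
    have hqL := (ProjectiveSpectrum.mem_zeroLocus _ _ _).mp hq
    have hspan : Ideal.span (Set.range Lf) ≤
        (ProjectiveSpectrum.asHomogeneousIdeal (𝒜 := MvPolynomial.homogeneousSubmodule (Fin (8 + 1)) K) q).toIdeal :=
      Ideal.span_le.mpr hqL
    refine (ProjectiveSpectrum.mem_zeroLocus _ _ _).mpr ?_
    rintro _ ⟨j, rfl⟩
    exact hspan (hMmem j)


end FatFlagToStrongLine


end Literature.AlgebraicGeometry.Motives

end
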